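import Summits.Ventures.CertifiedManyBodySolver.Upper.BlochDressedBoundTTPrime
import Summits.Ventures.CertifiedManyBodySolver.Upper.BlochDressedPeriodicTTPrime
import Summits.Ventures.CertifiedManyBodySolver.Upper.BlochDressedCellBound
import HarnessLib

/-!
# Ventures/CertifiedManyBodySolver — Upper/BlochDressedCellBoundTTPrime.lean

HONEST FRAMING: first certified bounds; not a superconductivity verdict; every number certified or labelled float.

THE `t–t'` PLAQUETTE-DRESSED BLOCH BOUND AS A CELL QUANTITY (hubbard-fast-atlas-2; step E of the `t–t'` twin of the chain
`Upper/BlochDressed*.lean`, `t' = 0` file `Upper/BlochDressedCellBound.lean`; theorem-only, nothing is claimed). For a dressing that is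
periodic under the magnetic cell (`u_c = v_{c mod q}`, even cell `M i = 2 q i`) the three cluster families of
`energyDensityTT'_le_dressed_bloch` and their decorrelation constants are `|k| ·` their offset sums (`Upper/BlochDressedPeriodic.lean` for
plaquettes and axial links — with the diagonal operators `D_plaq`, `D_e` riding on the same windows — and
`Upper/BlochDressedPeriodicTTPrime.lean` for the corner links), and `|k| · |cell| = (2m)²`:
* **`energyDensityTT'_le_dressedCell`** — `e(t,t',U;n̄) ≤ re 𝒞ᵗᵗ'_v(Q)/|cell| + K'_v/(2m)² + (16|t| + 32|t'|)/(2m)`, with the offset sums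
  `𝒞ᵗᵗ'_v(Q)` = plaquette windows `W₈(Q;r)` against `v_rᴴ(H_plaq + D_plaq)v_r`, axial-link windows `W₁₆(Q;r,j)` against
  `V_{r,j}ᴴ(T_j + D_j)V_{r,j}`, corner windows `W₁₆⁰(Q;r)`, `W₁₆¹(Q;r)` against `W_{r,d}ᴴ C_d W_{r,d}`, and the `|k|`-independent constant `K'_v`.
Sources: Bach–Lieb–Solovej 1994 (2c.36) [BachLiebSolovej1994]. Everything is proved; no definition.
-/

noncomputable section

namespace Summit.Ventures.CertifiedManyBodySolver.Upper

open Matrix Finset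
open Literature.MathematicalPhysics.QuantumLattice Literature.MathematicalPhysics.QuantumLattice.HartreeFock
  Literature.MathematicalPhysics.QuantumLattice.ThermodynamicLimit HeisenbergTL HubbardWave0 PlaquetteLUC
open scoped ComplexOrder ComplexConjugate

variable {m : ℕ} [NeZero m] {k M : Fin 2 → ℕ} [∀ i, NeZero (k i)] [∀ i, NeZero (M i)] {q : Fin 2 → ℕ}

/-- **The `t–t'` plaquette-dressed Bloch bound in cell form.** Torus `(ℤ/2m)²` (`m ≥ 2`), even magnetic cell `M i = 2 q i`,
`k i · M i = 2m`, blocks `Q σ κ` with spectra in `[0,1]`, `n̄ ∈ (0,2)`, `U ≥ 0`, real `t'`, a cell-periodic layer `u_c = v_{c mod q}` of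
number-conserving plaquette unitaries: `e(t,t',U;n̄) ≤ re 𝒞ᵗᵗ'_v(Q)/|cell| + K'_v/(2m)² + (16|t| + 32|t'|)/(2m)` (plaquette, axial-link and the
two kinds of corner-link offset sums). [cite: BachLiebSolovej1994, eq. (2c.36)] -/
theorem energyDensityTT'_le_dressedCell (hm : 2 ≤ m) (hkM : ∀ i, k i * M i = m * 2) (hq : ∀ i, M i = 2 * q i) (hq0 : ∀ i, 0 < q i)
    (t t' : ℝ) {U : ℝ} (hU : 0 ≤ U)
    (Q : Fin 2 → RectTorusSite k → Matrix (RectTorusSite M) (RectTorusSite M) ℂ) (hQh : ∀ σ κ, (Q σ κ).IsHermitian)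
    (h0 : ∀ σ κ i, 0 ≤ (hQh σ κ).eigenvalues i) (h1 : ∀ σ κ i, (hQh σ κ).eigenvalues i ≤ 1)
    (hn0 : 0 < (∑ σ, ∑ κ, (Q σ κ).trace).re / ((m * 2 : ℕ) : ℝ) ^ 2)
    (hn2 : (∑ σ, ∑ κ, (Q σ κ).trace).re / ((m * 2 : ℕ) : ℝ) ^ 2 < 2)
    (v : ((i : Fin 2) → Fin (q i)) → Matrix (Finset (Orb (FermionTorus 2 2))) (Finset (Orb (FermionTorus 2 2))) ℂ)
    (hv : ∀ r, (v r)ᴴ * v r = 1) (hvN : ∀ r, Commute totalNumberOp (v r)) :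
    energyDensityTT' t t' U ((∑ σ, ∑ κ, (Q σ κ).trace).re / ((m * 2 : ℕ) : ℝ) ^ 2) ≤
      ((∑ r : (i : Fin 2) → Fin (q i), ∑ s : Finset (Orb (FermionTorus 2 2)), ∑ s' : Finset (Orb (FermionTorus 2 2)),
              ((v r)ᴴ * (hamiltonian plaquetteGraph t U + hamiltonian plaquetteDiagGraph t' 0) * v r) s s' *
                slaterRDM (Matrix.of fun o o' : Orb (FermionTorus 2 2) => if (ofLex o).2 = (ofLex o').2 then
                  ((Fintype.card (RectTorusSite k) : ℂ))⁻¹ * ∑ κ, Q (ofLex o).2 κ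
                    (fun i => (((ofLex (ofLex o).1 i : ℕ) + 2 * (r i : ℕ) : ℕ) : ZMod (M i)))
                    (fun i => (((ofLex (ofLex o').1 i : ℕ) + 2 * (r i : ℕ) : ℕ) : ZMod (M i))) else 0) s s') +
          ((∑ r : (i : Fin 2) → Fin (q i), ∑ j : Fin 2, ∑ s : Finset (Orb (Fin 2 ×ₗ FermionTorus 2 2)), ∑ s' : Finset (Orb (Fin 2 ×ₗ FermionTorus 2 2)),
              ((fermionEmbed inlCell (v r) * fermionEmbed inrCell
                    (v (fun i => ⟨(if i = j then (r i : ℕ) + 1 else (r i : ℕ)) % q i, Nat.mod_lt _ (hq0 i)⟩)))ᴴ *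
                  (hamiltonian (linkGraph j) t 0 + hamiltonian (linkDiagGraph j) t' 0) *
                  (fermionEmbed inlCell (v r) * fermionEmbed inrCell
                    (v (fun i => ⟨(if i = j then (r i : ℕ) + 1 else (r i : ℕ)) % q i, Nat.mod_lt _ (hq0 i)⟩)))) s s' *
                slaterRDM (Matrix.of fun o o' : Orb (Fin 2 ×ₗ FermionTorus 2 2) => if (ofLex o).2 = (ofLex o').2 then
                  ((Fintype.card (RectTorusSite k) : ℂ))⁻¹ * ∑ κ, blockChar κ
                    ((if (ofLex (ofLex o).1).1 = 0 then (0 : RectTorusSite k) else if (r j : ℕ) + 1 < q j then 0 else Pi.single j 1) -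
                      (if (ofLex (ofLex o').1).1 = 0 then (0 : RectTorusSite k) else if (r j : ℕ) + 1 < q j then 0 else Pi.single j 1)) *
                    Q (ofLex o).2 κ
                      (fun i => (((ofLex (ofLex (ofLex o).1).2 i : ℕ) + 2 * (if (ofLex (ofLex o).1).1 = 0 then (r i : ℕ) else
                        if i = j then ((r j : ℕ) + 1) % q j else (r i : ℕ)) : ℕ) : ZMod (M i)))
                      (fun i => (((ofLex (ofLex (ofLex o').1).2 i : ℕ) + 2 * (if (ofLex (ofLex o').1).1 = 0 then (r i : ℕ) else
                        if i = j then ((r j : ℕ) + 1) % q j else (r i : ℕ)) : ℕ) : ZMod (M i))) else 0) s s') +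
          (∑ r : (i : Fin 2) → Fin (q i),
            ((∑ s : Finset (Orb (Fin 2 ×ₗ FermionTorus 2 2)), ∑ s' : Finset (Orb (Fin 2 ×ₗ FermionTorus 2 2)),
              ((fermionEmbed inlCell (v r) * fermionEmbed inrCell
                (v (fun i => ⟨((r i : ℕ) + 1) % q i, Nat.mod_lt _ (hq0 i)⟩)))ᴴ * hamiltonian (cornerGraph 0) t' 0 *
              (fermionEmbed inlCell (v r) * fermionEmbed inrCell
                (v (fun i => ⟨((r i : ℕ) + 1) % q i, Nat.mod_lt _ (hq0 i)⟩)))) s s' *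
            slaterRDM (Matrix.of fun o o' : Orb (Fin 2 ×ₗ FermionTorus 2 2) => if (ofLex o).2 = (ofLex o').2 then
              ((Fintype.card (RectTorusSite k) : ℂ))⁻¹ * ∑ κ, blockChar κ
                ((if (ofLex (ofLex o).1).1 = 0 then (0 : RectTorusSite k) else
                    ((if (r 0 : ℕ) + 1 < q 0 then 0 else Pi.single 0 1) + (if (r 1 : ℕ) + 1 < q 1 then 0 else Pi.single 1 1))) -
                  (if (ofLex (ofLex o').1).1 = 0 then (0 : RectTorusSite k) else
                    ((if (r 0 : ℕ) + 1 < q 0 then 0 else Pi.single 0 1) + (if (r 1 : ℕ) + 1 < q 1 then 0 else Pi.single 1 1)))) *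
                Q (ofLex o).2 κ
                  (fun i => (((ofLex (ofLex (ofLex o).1).2 i : ℕ) + 2 * (if (ofLex (ofLex o).1).1 = 0 then (r i : ℕ) else
                    ((r i : ℕ) + 1) % q i) : ℕ) : ZMod (M i)))
                  (fun i => (((ofLex (ofLex (ofLex o').1).2 i : ℕ) + 2 * (if (ofLex (ofLex o').1).1 = 0 then (r i : ℕ) else
                    ((r i : ℕ) + 1) % q i) : ℕ) : ZMod (M i))) else 0) s s') +
            (∑ s : Finset (Orb (Fin 2 ×ₗ FermionTorus 2 2)), ∑ s' : Finset (Orb (Fin 2 ×ₗ FermionTorus 2 2)),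
              ((fermionEmbed inlCell (v (fun i => ⟨(if i = 1 then (r i : ℕ) + 1 else (r i : ℕ)) % q i, Nat.mod_lt _ (hq0 i)⟩)) *
              fermionEmbed inrCell (v (fun i => ⟨(if i = 0 then (r i : ℕ) + 1 else (r i : ℕ)) % q i, Nat.mod_lt _ (hq0 i)⟩)))ᴴ *
              hamiltonian (cornerGraph 1) t' 0 *
              (fermionEmbed inlCell (v (fun i => ⟨(if i = 1 then (r i : ℕ) + 1 else (r i : ℕ)) % q i, Nat.mod_lt _ (hq0 i)⟩)) *
                fermionEmbed inrCell (v (fun i => ⟨(if i = 0 then (r i : ℕ) + 1 else (r i : ℕ)) % q i, Nat.mod_lt _ (hq0 i)⟩)))) s s' *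
            slaterRDM (Matrix.of fun o o' : Orb (Fin 2 ×ₗ FermionTorus 2 2) => if (ofLex o).2 = (ofLex o').2 then
              ((Fintype.card (RectTorusSite k) : ℂ))⁻¹ * ∑ κ, blockChar κ
                ((if (ofLex (ofLex o).1).1 = 0 then (if (r 1 : ℕ) + 1 < q 1 then (0 : RectTorusSite k) else Pi.single 1 1) else
                    (if (r 0 : ℕ) + 1 < q 0 then (0 : RectTorusSite k) else Pi.single 0 1)) -
                  (if (ofLex (ofLex o').1).1 = 0 then (if (r 1 : ℕ) + 1 < q 1 then (0 : RectTorusSite k) else Pi.single 1 1) else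
                    (if (r 0 : ℕ) + 1 < q 0 then (0 : RectTorusSite k) else Pi.single 0 1))) *
                Q (ofLex o).2 κ
                  (fun i => (((ofLex (ofLex (ofLex o).1).2 i : ℕ) + 2 * (if i = (if (ofLex (ofLex o).1).1 = 0 then 1 else 0) then
                    ((r i : ℕ) + 1) % q i else (r i : ℕ)) : ℕ) : ZMod (M i)))
                  (fun i => (((ofLex (ofLex (ofLex o').1).2 i : ℕ) + 2 * (if i = (if (ofLex (ofLex o').1).1 = 0 then 1 else 0) then
                    ((r i : ℕ) + 1) % q i else (r i : ℕ)) : ℕ) : ZMod (M i))) else 0) s s'))))).re /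
          ∏ i, (M i : ℝ) +
        ((∑ r : (i : Fin 2) → Fin (q i), ∑ s : Finset (Orb (FermionTorus 2 2)), ∑ s' : Finset (Orb (FermionTorus 2 2)),
              ‖((v r)ᴴ * (hamiltonian plaquetteGraph t U + hamiltonian plaquetteDiagGraph t' 0) * v r) s s'‖) *
            (2 ^ Fintype.card (Orb (FermionTorus 2 2)) * ((Fintype.card (Orb (FermionTorus 2 2))).factorial *
              (2 * (Fintype.card (Orb (FermionTorus 2 2)) : ℝ) ^ 2))) +
          ((∑ r : (i : Fin 2) → Fin (q i), ∑ j : Fin 2,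
              ∑ s : Finset (Orb (Fin 2 ×ₗ FermionTorus 2 2)), ∑ s' : Finset (Orb (Fin 2 ×ₗ FermionTorus 2 2)),
                ‖((fermionEmbed inlCell (v r) * fermionEmbed inrCell
                    (v (fun i => ⟨(if i = j then (r i : ℕ) + 1 else (r i : ℕ)) % q i, Nat.mod_lt _ (hq0 i)⟩)))ᴴ *
                  (hamiltonian (linkGraph j) t 0 + hamiltonian (linkDiagGraph j) t' 0) *
                  (fermionEmbed inlCell (v r) * fermionEmbed inrCell
                    (v (fun i => ⟨(if i = j then (r i : ℕ) + 1 else (r i : ℕ)) % q i, Nat.mod_lt _ (hq0 i)⟩)))) s s'‖) *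
            (2 ^ Fintype.card (Orb (Fin 2 ×ₗ FermionTorus 2 2)) * ((Fintype.card (Orb (Fin 2 ×ₗ FermionTorus 2 2))).factorial *
              (2 * (Fintype.card (Orb (Fin 2 ×ₗ FermionTorus 2 2)) : ℝ) ^ 2))) +
          (∑ r : (i : Fin 2) → Fin (q i),
            ((∑ s : Finset (Orb (Fin 2 ×ₗ FermionTorus 2 2)), ∑ s' : Finset (Orb (Fin 2 ×ₗ FermionTorus 2 2)),
              ‖((fermionEmbed inlCell (v r) * fermionEmbed inrCell
                (v (fun i => ⟨((r i : ℕ) + 1) % q i, Nat.mod_lt _ (hq0 i)⟩)))ᴴ * hamiltonian (cornerGraph 0) t' 0 *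
              (fermionEmbed inlCell (v r) * fermionEmbed inrCell
                (v (fun i => ⟨((r i : ℕ) + 1) % q i, Nat.mod_lt _ (hq0 i)⟩)))) s s'‖) +
            (∑ s : Finset (Orb (Fin 2 ×ₗ FermionTorus 2 2)), ∑ s' : Finset (Orb (Fin 2 ×ₗ FermionTorus 2 2)),
              ‖((fermionEmbed inlCell (v (fun i => ⟨(if i = 1 then (r i : ℕ) + 1 else (r i : ℕ)) % q i, Nat.mod_lt _ (hq0 i)⟩)) *
              fermionEmbed inrCell (v (fun i => ⟨(if i = 0 then (r i : ℕ) + 1 else (r i : ℕ)) % q i, Nat.mod_lt _ (hq0 i)⟩)))ᴴ *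
              hamiltonian (cornerGraph 1) t' 0 *
              (fermionEmbed inlCell (v (fun i => ⟨(if i = 1 then (r i : ℕ) + 1 else (r i : ℕ)) % q i, Nat.mod_lt _ (hq0 i)⟩)) *
                fermionEmbed inrCell (v (fun i => ⟨(if i = 0 then (r i : ℕ) + 1 else (r i : ℕ)) % q i, Nat.mod_lt _ (hq0 i)⟩)))) s s'‖))) *
            (2 ^ Fintype.card (Orb (Fin 2 ×ₗ FermionTorus 2 2)) * ((Fintype.card (Orb (Fin 2 ×ₗ FermionTorus 2 2))).factorial *
              (2 * (Fintype.card (Orb (Fin 2 ×ₗ FermionTorus 2 2)) : ℝ) ^ 2))))) / ((m * 2 : ℕ) : ℝ) ^ 2 +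
        (16 * |t| + 32 * |t'|) / ((m * 2 : ℕ) : ℝ) := by
  classical
  -- the periodic dressing on the torus
  obtain ⟨u, hu⟩ : ∃ u : (Fin 2 → Fin m) → Matrix (Finset (Orb (FermionTorus 2 2))) (Finset (Orb (FermionTorus 2 2))) ℂ,
      u = fun c => v (fun i => ⟨(c i : ℕ) % q i, Nat.mod_lt _ (hq0 i)⟩) := ⟨_, rfl⟩
  have huv : ∀ c, u c = v (fun i => ⟨(c i : ℕ) % q i, Nat.mod_lt _ (hq0 i)⟩) := fun c => by rw [hu]
  have huu : ∀ c, (u c)ᴴ * u c = 1 := fun c => by rw [huv]; exact hv _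
  have huN : ∀ c, Commute totalNumberOp (u c) := fun c => by rw [huv]; exact hvN _
  have hD := energyDensityTT'_le_dressed_bloch hm hkM t t' hU Q hQh h0 h1 hn0 hn2 u huu huN
  -- periodic reductions
  rw [sum_plaquetteTerm_eq_card_mul_sum_offset hkM hq hq0 Q (hamiltonian plaquetteGraph t U + hamiltonian plaquetteDiagGraph t' 0) u v huv,
    sum_linkTerm_eq_card_mul_sum_offset hkM hq hm hq0 Q (fun j => (hamiltonian (linkGraph j) t 0 + hamiltonian (linkDiagGraph j) t' 0)) u v huv,
    sum_cornerTerm_eq_card_mul_sum_offset hkM hq hm hq0 Q (fun d => hamiltonian (cornerGraph d) t' 0) u v huv,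
    sum_plaquetteNorm_eq_card_mul_sum_offset hkM hq hq0 (hamiltonian plaquetteGraph t U + hamiltonian plaquetteDiagGraph t' 0) u v huv,
    sum_linkNorm_eq_card_mul_sum_offset hkM hq hm hq0 (fun j => (hamiltonian (linkGraph j) t 0 + hamiltonian (linkDiagGraph j) t' 0)) u v huv,
    sum_cornerNorm_eq_card_mul_sum_offset hkM hq hm hq0 (fun d => hamiltonian (cornerGraph d) t' 0) u v huv] at hD
  -- arithmetic: `|k| · |cell| = (2m)²`
  have hK : (0 : ℝ) < (Fintype.card (RectTorusSite k) : ℝ) := by exact_mod_cast Fintype.card_pos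
  have hcell : (0 : ℝ) < ∏ i, (M i : ℝ) := Finset.prod_pos fun i _ => by exact_mod_cast Nat.pos_of_ne_zero (NeZero.ne (M i))
  have hL2 : ((m * 2 : ℕ) : ℝ) ^ 2 = (Fintype.card (RectTorusSite k) : ℝ) * ∏ i, (M i : ℝ) := (card_cells_mul_prod_side hkM).symm
  generalize (∑ r : (i : Fin 2) → Fin (q i), ∑ s : Finset (Orb (FermionTorus 2 2)), ∑ s' : Finset (Orb (FermionTorus 2 2)),
              ((v r)ᴴ * (hamiltonian plaquetteGraph t U + hamiltonian plaquetteDiagGraph t' 0) * v r) s s' *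
                slaterRDM (Matrix.of fun o o' : Orb (FermionTorus 2 2) => if (ofLex o).2 = (ofLex o').2 then
                  ((Fintype.card (RectTorusSite k) : ℂ))⁻¹ * ∑ κ, Q (ofLex o).2 κ
                    (fun i => (((ofLex (ofLex o).1 i : ℕ) + 2 * (r i : ℕ) : ℕ) : ZMod (M i)))
                    (fun i => (((ofLex (ofLex o').1 i : ℕ) + 2 * (r i : ℕ) : ℕ) : ZMod (M i))) else 0) s s') = CA at hD ⊢
  generalize (∑ r : (i : Fin 2) → Fin (q i), ∑ j : Fin 2, ∑ s : Finset (Orb (Fin 2 ×ₗ FermionTorus 2 2)), ∑ s' : Finset (Orb (Fin 2 ×ₗ FermionTorus 2 2)),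
              ((fermionEmbed inlCell (v r) * fermionEmbed inrCell
                    (v (fun i => ⟨(if i = j then (r i : ℕ) + 1 else (r i : ℕ)) % q i, Nat.mod_lt _ (hq0 i)⟩)))ᴴ *
                  (hamiltonian (linkGraph j) t 0 + hamiltonian (linkDiagGraph j) t' 0) *
                  (fermionEmbed inlCell (v r) * fermionEmbed inrCell
                    (v (fun i => ⟨(if i = j then (r i : ℕ) + 1 else (r i : ℕ)) % q i, Nat.mod_lt _ (hq0 i)⟩)))) s s' *
                slaterRDM (Matrix.of fun o o' : Orb (Fin 2 ×ₗ FermionTorus 2 2) => if (ofLex o).2 = (ofLex o').2 then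
                  ((Fintype.card (RectTorusSite k) : ℂ))⁻¹ * ∑ κ, blockChar κ
                    ((if (ofLex (ofLex o).1).1 = 0 then (0 : RectTorusSite k) else if (r j : ℕ) + 1 < q j then 0 else Pi.single j 1) -
                      (if (ofLex (ofLex o').1).1 = 0 then (0 : RectTorusSite k) else if (r j : ℕ) + 1 < q j then 0 else Pi.single j 1)) *
                    Q (ofLex o).2 κ
                      (fun i => (((ofLex (ofLex (ofLex o).1).2 i : ℕ) + 2 * (if (ofLex (ofLex o).1).1 = 0 then (r i : ℕ) else
                        if i = j then ((r j : ℕ) + 1) % q j else (r i : ℕ)) : ℕ) : ZMod (M i)))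
                      (fun i => (((ofLex (ofLex (ofLex o').1).2 i : ℕ) + 2 * (if (ofLex (ofLex o').1).1 = 0 then (r i : ℕ) else
                        if i = j then ((r j : ℕ) + 1) % q j else (r i : ℕ)) : ℕ) : ZMod (M i))) else 0) s s') = CB at hD ⊢
  generalize (∑ r : (i : Fin 2) → Fin (q i),
            ((∑ s : Finset (Orb (Fin 2 ×ₗ FermionTorus 2 2)), ∑ s' : Finset (Orb (Fin 2 ×ₗ FermionTorus 2 2)),
              ((fermionEmbed inlCell (v r) * fermionEmbed inrCell
                (v (fun i => ⟨((r i : ℕ) + 1) % q i, Nat.mod_lt _ (hq0 i)⟩)))ᴴ * hamiltonian (cornerGraph 0) t' 0 *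
              (fermionEmbed inlCell (v r) * fermionEmbed inrCell
                (v (fun i => ⟨((r i : ℕ) + 1) % q i, Nat.mod_lt _ (hq0 i)⟩)))) s s' *
            slaterRDM (Matrix.of fun o o' : Orb (Fin 2 ×ₗ FermionTorus 2 2) => if (ofLex o).2 = (ofLex o').2 then
              ((Fintype.card (RectTorusSite k) : ℂ))⁻¹ * ∑ κ, blockChar κ
                ((if (ofLex (ofLex o).1).1 = 0 then (0 : RectTorusSite k) else
                    ((if (r 0 : ℕ) + 1 < q 0 then 0 else Pi.single 0 1) + (if (r 1 : ℕ) + 1 < q 1 then 0 else Pi.single 1 1))) -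
                  (if (ofLex (ofLex o').1).1 = 0 then (0 : RectTorusSite k) else
                    ((if (r 0 : ℕ) + 1 < q 0 then 0 else Pi.single 0 1) + (if (r 1 : ℕ) + 1 < q 1 then 0 else Pi.single 1 1)))) *
                Q (ofLex o).2 κ
                  (fun i => (((ofLex (ofLex (ofLex o).1).2 i : ℕ) + 2 * (if (ofLex (ofLex o).1).1 = 0 then (r i : ℕ) else
                    ((r i : ℕ) + 1) % q i) : ℕ) : ZMod (M i)))
                  (fun i => (((ofLex (ofLex (ofLex o').1).2 i : ℕ) + 2 * (if (ofLex (ofLex o').1).1 = 0 then (r i : ℕ) else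
                    ((r i : ℕ) + 1) % q i) : ℕ) : ZMod (M i))) else 0) s s') +
            (∑ s : Finset (Orb (Fin 2 ×ₗ FermionTorus 2 2)), ∑ s' : Finset (Orb (Fin 2 ×ₗ FermionTorus 2 2)),
              ((fermionEmbed inlCell (v (fun i => ⟨(if i = 1 then (r i : ℕ) + 1 else (r i : ℕ)) % q i, Nat.mod_lt _ (hq0 i)⟩)) *
              fermionEmbed inrCell (v (fun i => ⟨(if i = 0 then (r i : ℕ) + 1 else (r i : ℕ)) % q i, Nat.mod_lt _ (hq0 i)⟩)))ᴴ *
              hamiltonian (cornerGraph 1) t' 0 *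
              (fermionEmbed inlCell (v (fun i => ⟨(if i = 1 then (r i : ℕ) + 1 else (r i : ℕ)) % q i, Nat.mod_lt _ (hq0 i)⟩)) *
                fermionEmbed inrCell (v (fun i => ⟨(if i = 0 then (r i : ℕ) + 1 else (r i : ℕ)) % q i, Nat.mod_lt _ (hq0 i)⟩)))) s s' *
            slaterRDM (Matrix.of fun o o' : Orb (Fin 2 ×ₗ FermionTorus 2 2) => if (ofLex o).2 = (ofLex o').2 then
              ((Fintype.card (RectTorusSite k) : ℂ))⁻¹ * ∑ κ, blockChar κ
                ((if (ofLex (ofLex o).1).1 = 0 then (if (r 1 : ℕ) + 1 < q 1 then (0 : RectTorusSite k) else Pi.single 1 1) else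
                    (if (r 0 : ℕ) + 1 < q 0 then (0 : RectTorusSite k) else Pi.single 0 1)) -
                  (if (ofLex (ofLex o').1).1 = 0 then (if (r 1 : ℕ) + 1 < q 1 then (0 : RectTorusSite k) else Pi.single 1 1) else
                    (if (r 0 : ℕ) + 1 < q 0 then (0 : RectTorusSite k) else Pi.single 0 1))) *
                Q (ofLex o).2 κ
                  (fun i => (((ofLex (ofLex (ofLex o).1).2 i : ℕ) + 2 * (if i = (if (ofLex (ofLex o).1).1 = 0 then 1 else 0) then
                    ((r i : ℕ) + 1) % q i else (r i : ℕ)) : ℕ) : ZMod (M i)))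
                  (fun i => (((ofLex (ofLex (ofLex o').1).2 i : ℕ) + 2 * (if i = (if (ofLex (ofLex o').1).1 = 0 then 1 else 0) then
                    ((r i : ℕ) + 1) % q i else (r i : ℕ)) : ℕ) : ZMod (M i))) else 0) s s'))) = CC at hD ⊢
  generalize (∑ r : (i : Fin 2) → Fin (q i), ∑ s : Finset (Orb (FermionTorus 2 2)), ∑ s' : Finset (Orb (FermionTorus 2 2)),
              ‖((v r)ᴴ * (hamiltonian plaquetteGraph t U + hamiltonian plaquetteDiagGraph t' 0) * v r) s s'‖) = nX at hD ⊢
  generalize (∑ r : (i : Fin 2) → Fin (q i), ∑ j : Fin 2,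
              ∑ s : Finset (Orb (Fin 2 ×ₗ FermionTorus 2 2)), ∑ s' : Finset (Orb (Fin 2 ×ₗ FermionTorus 2 2)),
                ‖((fermionEmbed inlCell (v r) * fermionEmbed inrCell
                    (v (fun i => ⟨(if i = j then (r i : ℕ) + 1 else (r i : ℕ)) % q i, Nat.mod_lt _ (hq0 i)⟩)))ᴴ *
                  (hamiltonian (linkGraph j) t 0 + hamiltonian (linkDiagGraph j) t' 0) *
                  (fermionEmbed inlCell (v r) * fermionEmbed inrCell
                    (v (fun i => ⟨(if i = j then (r i : ℕ) + 1 else (r i : ℕ)) % q i, Nat.mod_lt _ (hq0 i)⟩)))) s s'‖) = nY at hD ⊢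
  generalize (∑ r : (i : Fin 2) → Fin (q i),
            ((∑ s : Finset (Orb (Fin 2 ×ₗ FermionTorus 2 2)), ∑ s' : Finset (Orb (Fin 2 ×ₗ FermionTorus 2 2)),
              ‖((fermionEmbed inlCell (v r) * fermionEmbed inrCell
                (v (fun i => ⟨((r i : ℕ) + 1) % q i, Nat.mod_lt _ (hq0 i)⟩)))ᴴ * hamiltonian (cornerGraph 0) t' 0 *
              (fermionEmbed inlCell (v r) * fermionEmbed inrCell
                (v (fun i => ⟨((r i : ℕ) + 1) % q i, Nat.mod_lt _ (hq0 i)⟩)))) s s'‖) +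
            (∑ s : Finset (Orb (Fin 2 ×ₗ FermionTorus 2 2)), ∑ s' : Finset (Orb (Fin 2 ×ₗ FermionTorus 2 2)),
              ‖((fermionEmbed inlCell (v (fun i => ⟨(if i = 1 then (r i : ℕ) + 1 else (r i : ℕ)) % q i, Nat.mod_lt _ (hq0 i)⟩)) *
              fermionEmbed inrCell (v (fun i => ⟨(if i = 0 then (r i : ℕ) + 1 else (r i : ℕ)) % q i, Nat.mod_lt _ (hq0 i)⟩)))ᴴ *
              hamiltonian (cornerGraph 1) t' 0 *
              (fermionEmbed inlCell (v (fun i => ⟨(if i = 1 then (r i : ℕ) + 1 else (r i : ℕ)) % q i, Nat.mod_lt _ (hq0 i)⟩)) *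
                fermionEmbed inrCell (v (fun i => ⟨(if i = 0 then (r i : ℕ) + 1 else (r i : ℕ)) % q i, Nat.mod_lt _ (hq0 i)⟩)))) s s'‖))) = nZ at hD ⊢
  generalize (Fintype.card (Orb (FermionTorus 2 2))) = w₁ at hD ⊢
  generalize (Fintype.card (Orb (Fin 2 ×ₗ FermionTorus 2 2))) = w₂ at hD ⊢
  -- the arithmetic
  have hre : (((Fintype.card (RectTorusSite k) : ℂ)) * CA + (((Fintype.card (RectTorusSite k) : ℂ)) * CB +
      ((Fintype.card (RectTorusSite k) : ℂ)) * CC)).re = (Fintype.card (RectTorusSite k) : ℝ) * (CA + (CB + CC)).re := by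
    rw [← mul_add, ← mul_add, Complex.mul_re]
    simp [Complex.natCast_re, Complex.natCast_im]
  have e1 : (((Fintype.card (RectTorusSite k) : ℂ)) * CA + (((Fintype.card (RectTorusSite k) : ℂ)) * CB +
      ((Fintype.card (RectTorusSite k) : ℂ)) * CC)).re / ((m * 2 : ℕ) : ℝ) ^ 2 = (CA + (CB + CC)).re / ∏ i, (M i : ℝ) := by
    rw [hre, hL2]
    field_simp
  have e2 : ((Fintype.card (RectTorusSite k) : ℝ) * nX * (2 ^ w₁ * ((w₁.factorial : ℝ) * (2 * (w₁ : ℝ) ^ 2 / (Fintype.card (RectTorusSite k) : ℝ)))) +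
      ((Fintype.card (RectTorusSite k) : ℝ) * nY * (2 ^ w₂ * ((w₂.factorial : ℝ) * (2 * (w₂ : ℝ) ^ 2 / (Fintype.card (RectTorusSite k) : ℝ)))) +
      (Fintype.card (RectTorusSite k) : ℝ) * nZ * (2 ^ w₂ * ((w₂.factorial : ℝ) * (2 * (w₂ : ℝ) ^ 2 / (Fintype.card (RectTorusSite k) : ℝ)))))) =
      nX * (2 ^ w₁ * ((w₁.factorial : ℝ) * (2 * (w₁ : ℝ) ^ 2))) + (nY * (2 ^ w₂ * ((w₂.factorial : ℝ) * (2 * (w₂ : ℝ) ^ 2))) +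
        nZ * (2 ^ w₂ * ((w₂.factorial : ℝ) * (2 * (w₂ : ℝ) ^ 2)))) := by
    field_simp
  rw [e1, e2] at hD
  exact hD

end Summit.Ventures.CertifiedManyBodySolver.Upper
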